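import Summits.QuantumFields.BalabanUV.Beta.EriceRemainderEnclosureHistoryAutonomyComparison
import Summits.QuantumFields.BalabanUV.Beta.EriceRemainderEnclosureHistoryAutonomyComparisonGap
import Summits.QuantumFields.BalabanUV.Beta.EriceRemainderEnclosureHistoryAutonomyFunctionalShiftWitness

/-!
# EriceRemainderEnclosureHistoryAutonomyFunctionalShiftDivergence — (E51g) THE DIVERGENT HALF OF THE DICHOTOMY FOR ANTITONE MEMORY: for `B` ANTITONE in the
# history on ]0,γ]^ℕ and a perturbation `B′` whose excess is bounded BELOW, `B′ − B ≥ ρ(u 0)` (`ρ` non-decreasing), with `B′ ≤ U` on the box, the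
# level gap of ordered box solutions `h′ ≤ h` from one pin dominates `Σ_{i≤j} ρ((1∕p² + i·U)^{−1∕2})` ((E49f)'s accumulated excess read through the LOWER
# envelope of `h′`); so a non-summable profile — every power `C·(u 0)^s` with `s ≤ 2` (`γ ≤ 1`) — drives `1∕h′_m² − 1∕h_m² → +∞`: the remainder CHANGES
# THE RUNNING.  On the closed threshold `M·γ ≤ 3√3·b` the order `h′ ≤ h` is (E49a)'s and no order hypothesis remains.  With (E51b) (`|B′ − B| ≤ C·a^s`,
# `s > 2` ⟹ the shift converges) this is the DICHOTOMY BY EXPONENT for antitone memory, now for GENERAL `B` (not only (E51c)'s Markov pair)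

Cell `pub-balaban`, β-function sub-cell, BINDER row D4 «RemainderConst leaves for Bałaban's split» (`HOME/BINDER-OWNERS.md`; owner lineage `b2b-balaban-beta-an4`;
this file by co-owner #2 lineage `b2b-balaban-beta-d4-p2`, generation 47), β-FLOW TEAM duty (1), FREEZE (0) honoured (def-free; (E49a)'s `drive_le_mul_of_le` ∕
`le_of_functional_le_zs_closed`, (E49f)'s `excess_sum_le_gap`, (E51c)'s `tendsto_sum_rpow_envelope_atTop`, node U2's `MemFlow` ∕ `SeqBox` ∕ `invSq_eq_of_memFlow`
BY NAME).  Sequel of (E49f) `…ComparisonGap` and (E51c) `…FunctionalShiftWitness`; companion (E51b) `…FunctionalShiftLimit` (the convergent half).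

HONEST FRAMING (page 1, verbatim and binding).  *"Discharging BetaPertH makes Bałaban's UV stability UNCONDITIONAL — a real constructive-QFT result; it is
NOT the continuum limit and NOT the Clay problem."*  THIS FILE DISCHARGES NOTHING OF THE KIND.  Elementary real analysis about ABSTRACT functionals with a
displayed sign of the memory and a displayed lower bound on the excess — hypotheses, not facts; the sign of Bałaban's memory and the profile of its
remainder are NOT PRINTED ([I] p. 298; GAPS G-t4-U2-1∕-2) and not asserted.  Row D4 class UNCHANGED (critical-path width 0; instance 0∕1; D4 DISCHARGE
NO DATE).  HONEST DEPENDENCY: continuum YM on T⁴ ⇐ BetaPertH ∧ nine spine estimates (0/9 proved); BetaPertH ⇐ (D1) ∧ (D4) ∧ CAP+tail; G-an2-4 gates asym,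
D1 and NE2/3/4.

WHAT IS PROVED ([folklore]; 0 `def`, 0 sorry).  §1 `envelopeU_le` (`B′ ≤ U` ⟹ `h′_m ≥ (1∕p² + m·U)^{−1∕2}`).  §2 **`sum_profile_le_gap`** (antitone `B`,
`B′ − B ≥ ρ(u 0)`, `h′ ≤ h` ⟹ `Σ_{i<j} ρ((1∕p² + (i+1)U)^{−1∕2}) ≤ 1∕h′_j² − 1∕h_j²`), **`tendsto_gap_atTop`**, **`tendsto_gap_atTop_of_rpow_excess`** (`s ≤ 2`).
§3 **`tendsto_gap_atTop_zs_closed`** (the same on the closed threshold `M·γ ≤ 3√3·b`, the order supplied by (E49a)).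
-/

noncomputable section
open Filter Topology Finset

namespace Summit.QuantumFields.BalabanUV.Beta.EriceRemainderEnclosureHistoryAutonomyFunctionalShiftDivergence

open Literature.MathematicalPhysics.QuantumFieldTheory.Balaban1983to89
open Literature.MathematicalPhysics.QuantumFieldTheory.Balaban1983to89.T4BetaStationary
open Literature.MathematicalPhysics.QuantumFieldTheory.Balaban1983to89.T4BetaFlowWellPosed
open Summit.QuantumFields.BalabanUV.Beta.EriceRemainderEnclosureHistoryAutonomyComparison
  (drive_le_mul_of_le le_of_functional_le_zs_closed)
open Summit.QuantumFields.BalabanUV.Beta.EriceRemainderEnclosureHistoryAutonomyComparisonGap (excess_sum_le_gap)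
open Summit.QuantumFields.BalabanUV.Beta.EriceRemainderEnclosureHistoryAutonomyFunctionalShiftWitness
  (tendsto_sum_rpow_envelope_atTop)

variable {B B' : (ℕ → ℝ) → ℝ} {M γ b p U : ℝ} {h h' : ℕ → ℝ} {ρ : ℝ → ℝ}

/-! ## §1 The lower envelope of the perturbed trajectory -/

/-- A box solution of a flow whose functional is AT MOST `U` on the box runs ABOVE the `U`-envelope: `1∕√(1∕p² + m·U) ≤ h′_m`. [folklore] -/
theorem envelopeU_le (hup' : ∀ u, SeqBox γ u → B' u ≤ U) (hh' : SeqBox γ h') (hf' : MemFlow B' p h') (m : ℕ) :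
    1 / Real.sqrt (1 / p ^ 2 + (m : ℝ) * U) ≤ h' m := by
  have hS : 1 / h' m ^ 2 ≤ 1 / p ^ 2 + (m : ℝ) * U := by
    rw [invSq_eq_of_memFlow hf' m]
    exact add_le_add le_rfl (drive_le_mul_of_le hup' hh' m)
  have hpos : 0 < 1 / h' m ^ 2 := by have := (hh' m).1; positivity
  calc 1 / Real.sqrt (1 / p ^ 2 + (m : ℝ) * U) ≤ 1 / Real.sqrt (1 / h' m ^ 2) := one_div_sqrt_anti hpos hS
    _ = h' m := one_div_sqrt_one_div_sq (hh' m).1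

/-! ## §2 Antitone memory: the level gap dominates the excess profile summed along the lower envelope -/

/-- **THE GAP DOMINATES THE PROFILE ALONG THE LOWER ENVELOPE.**  `B` ANTITONE on the box, `B′ − B ≥ ρ(u 0)` on the box with `ρ` non-decreasing on ]0,γ],
`B′ ≤ U` on the box, `h, h′` box solutions of `B, B′` from one pin `p > 0` with `h′ ≤ h` (as (E49a) supplies in every uniqueness regime of `B`).  Then
`Σ_{i<j} ρ(1∕√(1∕p² + (i+1)·U)) ≤ 1∕h′_j² − 1∕h_j²` — (E49f)'s accumulated excess read through the lower envelope of `h′`. [folklore] -/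
theorem sum_profile_le_gap (hanti : ∀ u u' : ℕ → ℝ, SeqBox γ u → SeqBox γ u' → (∀ j, u j ≤ u' j) → B u' ≤ B u)
    (hexc : ∀ u, SeqBox γ u → ρ (u 0) ≤ B' u - B u) (hρm : ∀ a a', 0 < a → a ≤ a' → a' ≤ γ → ρ a ≤ ρ a')
    (hup' : ∀ u, SeqBox γ u → B' u ≤ U) (hU : 0 ≤ U) (hp : 0 < p) (hh : SeqBox γ h) (hh' : SeqBox γ h') (hf : MemFlow B p h)
    (hf' : MemFlow B' p h') (hle : ∀ j, h' j ≤ h j) (j : ℕ) :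
    ∑ i ∈ range j, ρ (1 / Real.sqrt (1 / p ^ 2 + ((i : ℝ) + 1) * U)) ≤ 1 / h' j ^ 2 - 1 / h j ^ 2 := by
  refine le_trans (sum_le_sum fun i _ => ?_) (excess_sum_le_gap hanti hh hh' hf hf' hle j)
  have h1 := envelopeU_le hup' hh' hf' (i + 1)
  push_cast at h1
  have h2 := hexc _ (seqBox_shift hh' (i + 1))
  simp only [add_zero] at h2
  exact (hρm _ _ (by positivity) h1 (hh' (i + 1)).2).trans h2

/-- **DIVERGENCE FOR ANTITONE MEMORY**: if moreover the profile summed along the `U`-envelope is unbounded, the level gap tends to `+∞` — the remainder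
CHANGES THE RUNNING of the levels; no finite Λ-shift. [folklore] -/
theorem tendsto_gap_atTop (hanti : ∀ u u' : ℕ → ℝ, SeqBox γ u → SeqBox γ u' → (∀ j, u j ≤ u' j) → B u' ≤ B u)
    (hexc : ∀ u, SeqBox γ u → ρ (u 0) ≤ B' u - B u) (hρm : ∀ a a', 0 < a → a ≤ a' → a' ≤ γ → ρ a ≤ ρ a')
    (hup' : ∀ u, SeqBox γ u → B' u ≤ U) (hU : 0 ≤ U) (hp : 0 < p) (hh : SeqBox γ h) (hh' : SeqBox γ h') (hf : MemFlow B p h)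
    (hf' : MemFlow B' p h') (hle : ∀ j, h' j ≤ h j)
    (hdiv : Tendsto (fun m => ∑ i ∈ range m, ρ (1 / Real.sqrt (1 / p ^ 2 + ((i : ℝ) + 1) * U))) atTop atTop) :
    Tendsto (fun m => 1 / h' m ^ 2 - 1 / h m ^ 2) atTop atTop :=
  tendsto_atTop_mono (fun m => sum_profile_le_gap hanti hexc hρm hup' hU hp hh hh' hf hf' hle m) hdiv

/-- **POWER EXCESS WITH EXPONENT `s ≤ 2` CHANGES THE RUNNING (antitone memory)**: `B′ − B ≥ C·(u 0)^s` on the box with `C > 0`, `0 ≤ s ≤ 2`, `γ ≤ 1`,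
`B′ ≤ U` (`U > 0`), ordered box solutions `h′ ≤ h` from one pin ⟹ `1∕h′_m² − 1∕h_m² → +∞` (harmonic comparison of (E51c)). [folklore] -/
theorem tendsto_gap_atTop_of_rpow_excess {C s : ℝ}
    (hanti : ∀ u u' : ℕ → ℝ, SeqBox γ u → SeqBox γ u' → (∀ j, u j ≤ u' j) → B u' ≤ B u)
    (hexc : ∀ u, SeqBox γ u → C * (u 0) ^ s ≤ B' u - B u) (hC : 0 < C) (hs0 : 0 ≤ s) (hs2 : s ≤ 2) (hγ1 : γ ≤ 1)
    (hup' : ∀ u, SeqBox γ u → B' u ≤ U) (hU : 0 < U) (hp : 0 < p) (hpγ : p ≤ γ) (hh : SeqBox γ h) (hh' : SeqBox γ h')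
    (hf : MemFlow B p h) (hf' : MemFlow B' p h') (hle : ∀ j, h' j ≤ h j) :
    Tendsto (fun m => 1 / h' m ^ 2 - 1 / h m ^ 2) atTop atTop :=
  tendsto_gap_atTop (ρ := fun a : ℝ => C * a ^ s) hanti hexc
    (fun _ _ ha haa' _ => mul_le_mul_of_nonneg_left (Real.rpow_le_rpow ha.le haa' hs0) hC.le) hup' hU.le hp hh hh' hf hf' hle
    (tendsto_sum_rpow_envelope_atTop hp (hpγ.trans hγ1) hU hC hs2)

/-! ## §3 The dichotomy's divergent half on the closed threshold, the order supplied by (E49a) -/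

/-- **ON THE CLOSED THRESHOLD NO ORDER HYPOTHESIS IS NEEDED**: `B` antitone with zeroth moment `M`, floor `b`, `M·γ ≤ 3√3·b` (so (E49a)
`le_of_functional_le_zs_closed` orders the trajectories), `B′ ≥ B + C·(u 0)^s` on the box (`C > 0`, `0 ≤ s ≤ 2`, `γ ≤ 1`), `B′ ≤ U`; then for the box
solution `h` of `B` and ANY box solution `h′` of `B′` from one pin `p`: `1∕h′_m² − 1∕h_m² → +∞`.  With (E51b) `exists_tendsto_disc_of_rpow` (`s > 2`: the shift
converges) this is the DICHOTOMY by exponent for antitone memory. [folklore] -/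
theorem tendsto_gap_atTop_zs_closed {C s : ℝ}
    (hanti : ∀ u u' : ℕ → ℝ, SeqBox γ u → SeqBox γ u' → (∀ j, u j ≤ u' j) → B u' ≤ B u)
    (hB : ∀ u u' : ℕ → ℝ, SeqBox γ u → SeqBox γ u' → ∀ D : ℝ, (∀ j, |u j - u' j| ≤ D) → |B u - B u'| ≤ M * D)
    (hM : 0 ≤ M) (hp : 0 < p) (hpγ : p ≤ γ) (hγ1 : γ ≤ 1) (hb : 0 < b) (hlo : ∀ u, SeqBox γ u → b ≤ B u)
    (hsmall : M * γ ≤ 3 * Real.sqrt 3 * b) (hexc : ∀ u, SeqBox γ u → C * (u 0) ^ s ≤ B' u - B u) (hC : 0 < C) (hs0 : 0 ≤ s)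
    (hs2 : s ≤ 2) (hup' : ∀ u, SeqBox γ u → B' u ≤ U) (hU : 0 < U) (hh : SeqBox γ h) (hh' : SeqBox γ h') (hf : MemFlow B p h)
    (hf' : MemFlow B' p h') : Tendsto (fun m => 1 / h' m ^ 2 - 1 / h m ^ 2) atTop atTop := by
  have hBB' : ∀ u, SeqBox γ u → B u ≤ B' u := fun u hu => by
    have h1 := hexc u hu
    have h2 : 0 ≤ C * (u 0) ^ s := mul_nonneg hC.le (Real.rpow_nonneg (hu 0).1.le s)
    linarith
  exact tendsto_gap_atTop_of_rpow_excess hanti hexc hC hs0 hs2 hγ1 hup' hU hp hpγ hh hh' hf hf'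
    (le_of_functional_le_zs_closed hanti hB hM hp hpγ hb hlo hsmall hBB' hh hf hh' hf')

end Summit.QuantumFields.BalabanUV.Beta.EriceRemainderEnclosureHistoryAutonomyFunctionalShiftDivergence

end
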